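import Literature.Barriers.CriticalPhenomena.PositionSpaceRGNonGibbsianIsraelOddGraph
import Literature.Probability.LatticeModels.GaussianPairingBoundCouplings
import HarnessLib

/-!
# Israel's example (van Enter–Fernández–Sokal 1993, §4.1.2): dedecoration — integrating out the
# midpoints of the reduced system (Step 1 / Step 2, eqs. (4.6))

Companion file of `PositionSpaceRGNonGibbsianIsraelOddGraph.lean`. The reduced system of Step 2
(Figure 4(c): `+`-boundary Ising model on `cutGraph n` in the internal volume `W'_n`, coupling `β`,
no bulk field) is dedecorated exactly as printed: "we can explicitly integrate out the spins in the
decorated lattice that have exactly two neighbors, yielding an effective coupling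
`J' = ½ log cosh 2J` between those two neighbors" (p. 94), "Similarly, we can integrate out the
spins in `Γ^int_{R+2}`, yielding an effective magnetic field `h' = ½ log cosh 2J > 0` … But this
last system is equivalent to a square lattice of size `(R+2) × (R+2)` with nearest-neighbor
coupling `J'` and `+` boundary conditions" (p. 97), and (4.6): "`⟨σ_{i₁,i₂}⟩_{Λ^int_{R+2}} =
⟨tanh(J(σ'+σ''))⟩_{R+2} = ⟨½ tanh 2J (σ'+σ'')⟩_{R+2}`, where `σ'` and `σ''` are the two internal
spins adjacent to `σ_{i₁,i₂}`".

The computation: by the two-step decomposition of the Boltzmann sums of `W'_n` over the midpoints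
(`sum_isingWeight_fixed_eq_sum_sum`; no extra factor since every bond meets a midpoint), for frozen
centres `τ₂` the midpoints are independent spins `s_m` with energies `β s_m (σ' + σ'')` (field
`frozenField_midOf`), so the inner sums factorise (`sum_prod_eq_prod_add`):
`∑_{s} e^{β s(σ'+σ'')} = 2 cosh β(σ'+σ'') = 2e^{J'} e^{J'σ'σ''}` (the tree's one-decoration identity
`PairIsing.sum_units_exp_decoration`, effective coupling `J' = PairIsing.decorK β = ½ log cosh 2β` of
`GaussianPairingBoundCouplings.lean`, reused here) and
`∑_s s e^{β s(σ'+σ'')} = tanh(β(σ'+σ'')) · 2cosh(…)`, `tanh β(σ'+σ'') = ½ tanh 2β (σ'+σ'')`; the product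
over the midpoints of the box (↔ the bonds of the rescaled lattice meeting the rescaled box) is
`(2e^{J'})^N` times the `+`-boundary Boltzmann weight of the dedecorated lattice `oddGraph` at
coupling `J'` on the centres.

## What is formalised (namespace `Literature.Barriers.CriticalPhenomena.NonGibbs`)

The effective coupling `J'` is the tree's `PairIsing.decorK` (not redefined); the per-bond identities
`two_mul_cosh_pm_eq` (a `cosh` rewriting of `PairIsing.sum_units_exp_decoration`), `tanh_pm_add_eq`,
the inner-sum factorisations, `prod_cosh_midField_eq` (the cosh product as the
dedecorated weight), and the dedecoration theorems `sum_isingWeight_cut_eq_local` (observables not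
reading the midpoints), `isingPartitionFunction_cut_eq`, `isingExpect_cut_eq_oddGraph`, and
`isingExpect_cut_spinAt_midOf` — eq. (4.6): `⟨σ_{midOf ε}⟩_{Q_n} = ½ tanh 2β
(⟨σ_{centerEmb ε.tip}⟩ + ⟨σ_{centerEmb ε.1}⟩)` in the dedecorated `+`-boundary system. All proved;
no named facts.
-/

noncomputable section

namespace Literature.Barriers.CriticalPhenomena.NonGibbs

open Finset Literature.Probability.LatticeModels Literature.Probability.LatticeModels.AEdge

/-! ### The effective coupling and the per-bond identities -/

/-- **Integrating out a spin with two neighbours**: for `u, v = ±1`,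
`∑_{s=±1} e^{β s (u+v)} = 2 cosh β(u+v) = 2e^{J'} · e^{J' u v}` with `J' = PairIsing.decorK β =
½ log cosh 2β` ("yielding an effective coupling `J' = ½ log cosh 2J` between those two neighbors";
with `v = 1`, the frozen `+` neighbour of a boundary midpoint, this is the effective field `h' = J'`).
A convenience `cosh` form of the tree's `PairIsing.sum_units_exp_decoration` (same right-hand side),
which is the shape produced by the factorised midpoint sums below.
[cite: VanenterFernandezSokal1993, §4.1.2 Step 1 and Step 2] -/
theorem two_mul_cosh_pm_eq (β : ℝ) {u v : ℝ} (hu : u = 1 ∨ u = -1) (hv : v = 1 ∨ v = -1) :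
    2 * Real.cosh (β * (u + v)) =
      2 * Real.exp (PairIsing.decorK β) * Real.exp (PairIsing.decorK β * (u * v)) := by
  rw [← PairIsing.sum_units_exp_decoration β hu hv, UnitsInt.univ, Finset.sum_insert (by decide),
    Finset.sum_singleton, Real.cosh_eq]
  simp only [Units.val_one, Int.cast_one, Units.val_neg, Int.cast_neg]
  rw [show β * (1 * u + 1 * v) = β * (u + v) by ring,
    show β * (-1 * u + -1 * v) = -(β * (u + v)) by ring]
  ring

/-- **The conditional magnetisation of a midpoint**, eq. (4.6): for `u, v = ±1`,
`tanh(β(u+v)) = ½ tanh 2β · (u + v)`. [cite: VanenterFernandezSokal1993, §4.1.2 Step 2 eq. (4.6)] -/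
theorem tanh_pm_add_eq (β : ℝ) {u v : ℝ} (hu : u = 1 ∨ u = -1) (hv : v = 1 ∨ v = -1) :
    Real.tanh (β * (u + v)) = Real.tanh (2 * β) / 2 * (u + v) := by
  rcases hu with rfl | rfl <;> rcases hv with rfl | rfl
  · rw [show β * (1 + 1) = 2 * β by ring]; ring
  · simp
  · simp
  · rw [show β * (-1 + -1) = -(2 * β) by ring, Real.tanh_neg]; ring

/-! ### Sums over the configurations of the midpoints factorise -/

/-- `∑_{τ : M → {±1}} ∏_m φ_m(τ_m) = ∏_m (φ_m(1) + φ_m(-1))` (independent spins).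
[cite: VanenterFernandezSokal1993, §4.1.2 Step 1 ("explicitly integrate out the spins")] -/
theorem sum_prod_eq_prod_add {ι : Type*} [Fintype ι] [DecidableEq ι] (φ : ι → ℤˣ → ℝ) :
    ∑ τ : ι → ℤˣ, ∏ m, φ m (τ m) = ∏ m, (φ m 1 + φ m (-1)) := by
  rw [← Fintype.piFinset_univ, ← Finset.prod_univ_sum]
  refine Finset.prod_congr rfl fun m _ => ?_
  rw [UnitsInt.univ, Finset.sum_pair (by decide)]

/-! ### The inner system: midpoints fluctuating, centres frozen -/

/-- The effective field at `m` from the spins that are neither midpoints nor cut (its centres; for a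
boundary midpoint also its outside centre). [cite: VanenterFernandezSokal1993, §4.1.2 Steps 1–2] -/
def midField (n : ℕ) (ζ : SpinConfig (Site 2)) (m : Site 2) : ℝ :=
  frozenField (fun z => z ∈ midFinset n ∨ IsCutSite n z) (fun z => spinAt z ζ) m

/-- **The energy of the inner system is a sum of one-body terms**: with the centres frozen to `ζ`,
`-H^{ζ}_{cut; midpoints}(τ₁ ∨ ζ) = ∑_{m ∈ midpoints} (τ₁)_m · midField(m)` (no bond joins two
midpoints; the bonds across are cut). [cite: VanenterFernandezSokal1993, §4.1.2 Step 1, Figure 3(b)] -/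
theorem neg_isingHamiltonian_cut_midFinset (n : ℕ) (ζ : SpinConfig (Site 2))
    (τ₁ : ↥(midFinset n) → ℤˣ) :
    -isingHamiltonian (cutGraph n) (midFinset n) 0 (.fixed ζ) (glue (midFinset n) τ₁ (.fixed ζ)) =
      ∑ m ∈ midFinset n, spinAt m (glue (midFinset n) τ₁ (.fixed ζ)) * midField n ζ m := by
  classical
  set σ := glue (midFinset n) τ₁ (.fixed ζ) with hσ
  simp only [isingHamiltonian, interactionEdges_fixed, zero_mul, sub_zero, neg_neg]
  rw [edgesTouching_cutGraph_eq_image', Finset.sum_image fun ε _ ε' _ h => toSym2_injective h]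
  simp only [bondSpin_toSym2]
  rw [sum_anchT_filter_eq (midFinset n) (fun z => ¬ IsCutSite n z)
    (fun m hm => not_isCutSite_of_mem_midFinset hm) σ, anch_midFinset_eq_empty, Finset.sum_empty,
    zero_add]
  refine Finset.sum_congr rfl fun m _ => congrArg₂ (· * ·) rfl ?_
  unfold midField
  rw [frozenField_congr (P' := fun z => z ∈ midFinset n ∨ IsCutSite n z) (fun z => by rw [not_not])]
  refine frozenField_congr_fun (fun z hz => ?_) m
  have hzM : z ∉ midFinset n := fun h => hz (Or.inl h)
  simp only [spinAt, hσ, glue_apply_of_notMem _ _ _ hzM, BoundaryCondition.outside_fixed]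

/-- The Boltzmann weight of the inner system is a product of one-body factors.
[cite: VanenterFernandezSokal1993, §4.1.2 Step 1] -/
theorem isingWeight_cut_midFinset_eq_prod (n : ℕ) (β : ℝ) (ζ : SpinConfig (Site 2))
    (τ₁ : ↥(midFinset n) → ℤˣ) :
    isingWeight (cutGraph n) (midFinset n) β 0 (.fixed ζ) τ₁ =
      ∏ m : ↥(midFinset n), Real.exp (β * ((τ₁ m : ℤ) : ℝ) * midField n ζ m) := by
  rw [isingWeight, show -β * isingHamiltonian (cutGraph n) (midFinset n) 0 (.fixed ζ)
      (glue (midFinset n) τ₁ (.fixed ζ)) = β * -isingHamiltonian (cutGraph n) (midFinset n) 0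
      (.fixed ζ) (glue (midFinset n) τ₁ (.fixed ζ)) by ring, neg_isingHamiltonian_cut_midFinset,
    Finset.mul_sum, ← Finset.sum_coe_sort, Real.exp_sum]
  refine Finset.prod_congr rfl fun m _ => ?_
  rw [show spinAt (m : Site 2) (glue (midFinset n) τ₁ (.fixed ζ)) = ((τ₁ m : ℤ) : ℝ) by
    simp only [spinAt, glue_apply_of_mem _ _ _ m.2]]
  ring_nf

/-- **Inner sum, observables not reading the midpoints**: `∑_{τ₁} w(τ₁) F(τ₁ ∨ ζ) =
F(ζ) · ∏_{m} 2cosh(β · midField m)`. [cite: VanenterFernandezSokal1993, §4.1.2 Step 1] -/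
theorem sum_isingWeight_cut_midFinset_local (n : ℕ) (β : ℝ) (ζ : SpinConfig (Site 2))
    {F : SpinConfig (Site 2) → ℝ}
    (hF : ∀ σ σ' : SpinConfig (Site 2), (∀ z ∉ midFinset n, σ z = σ' z) → F σ = F σ') :
    ∑ τ₁ : ↥(midFinset n) → ℤˣ, isingWeight (cutGraph n) (midFinset n) β 0 (.fixed ζ) τ₁ *
        F (glue (midFinset n) τ₁ (.fixed ζ)) =
      F ζ * ∏ m ∈ midFinset n, 2 * Real.cosh (β * midField n ζ m) := by
  classical
  have hFζ : ∀ τ₁ : ↥(midFinset n) → ℤˣ, F (glue (midFinset n) τ₁ (.fixed ζ)) = F ζ := fun τ₁ =>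
    hF _ _ fun z hz => by rw [glue_apply_of_notMem _ _ _ hz, BoundaryCondition.outside_fixed]
  simp_rw [hFζ, isingWeight_cut_midFinset_eq_prod]
  rw [← Finset.sum_mul, mul_comm]
  change F ζ * ∑ τ : ↥(midFinset n) → ℤˣ, ∏ m, (fun (m : ↥(midFinset n)) (s : ℤˣ) =>
    Real.exp (β * ((s : ℤ) : ℝ) * midField n ζ m)) m (τ m) = _
  rw [sum_prod_eq_prod_add (φ := fun (m : ↥(midFinset n)) (s : ℤˣ) =>
    Real.exp (β * ((s : ℤ) : ℝ) * midField n ζ m)), ← Finset.prod_coe_sort (midFinset n)]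
  refine congrArg₂ (· * ·) rfl (Finset.prod_congr rfl fun m _ => ?_)
  simp only [Units.val_one, Units.val_neg, Int.cast_one, Int.cast_neg, Real.cosh_eq]
  ring_nf

/-- **Inner sum, the spin of one midpoint** (the numerator of the conditional magnetisation of
(4.6)): `∑_{τ₁} w(τ₁) (τ₁)_{m₀} = tanh(β · midField m₀) · ∏_m 2cosh(β · midField m)`.
[cite: VanenterFernandezSokal1993, §4.1.2 Step 2 eq. (4.6)] -/
theorem sum_isingWeight_cut_midFinset_spinAt (n : ℕ) (β : ℝ) (ζ : SpinConfig (Site 2))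
    {m₀ : Site 2} (hm₀ : m₀ ∈ midFinset n) :
    ∑ τ₁ : ↥(midFinset n) → ℤˣ, isingWeight (cutGraph n) (midFinset n) β 0 (.fixed ζ) τ₁ *
        spinAt m₀ (glue (midFinset n) τ₁ (.fixed ζ)) =
      Real.tanh (β * midField n ζ m₀) * ∏ m ∈ midFinset n, 2 * Real.cosh (β * midField n ζ m) := by
  classical
  set a : ↥(midFinset n) := ⟨m₀, hm₀⟩ with ha
  -- the summand as a product of one-body factors, the factor at `m₀` carrying the spin
  set φ : ↥(midFinset n) → ℤˣ → ℝ := fun m s =>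
    Real.exp (β * ((s : ℤ) : ℝ) * midField n ζ m) * (if m = a then ((s : ℤ) : ℝ) else 1) with hφ
  have hsummand : ∀ τ₁ : ↥(midFinset n) → ℤˣ,
      isingWeight (cutGraph n) (midFinset n) β 0 (.fixed ζ) τ₁ *
        spinAt m₀ (glue (midFinset n) τ₁ (.fixed ζ)) = ∏ m, φ m (τ₁ m) := by
    intro τ₁
    rw [isingWeight_cut_midFinset_eq_prod]
    simp only [hφ, Finset.prod_mul_distrib]
    refine congrArg₂ (· * ·) rfl ?_
    rw [Finset.prod_ite_eq' Finset.univ a (fun x => (((τ₁ x : ℤˣ) : ℤ) : ℝ)), if_pos (Finset.mem_univ a)]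
    simp only [spinAt, ha, glue_apply_of_mem _ _ _ hm₀]
  simp_rw [hsummand]
  rw [sum_prod_eq_prod_add]
  -- `φ_m(1) + φ_m(-1) = 2cosh(β h_m) · (tanh(β h_{m₀}) if m = m₀ else 1)`
  have hfac : ∀ m : ↥(midFinset n), φ m 1 + φ m (-1) =
      2 * Real.cosh (β * midField n ζ m) * (if m = a then Real.tanh (β * midField n ζ m₀) else 1) := by
    intro m
    simp only [hφ, Units.val_one, Units.val_neg, Int.cast_one, Int.cast_neg]
    by_cases hm : m = a
    · rw [if_pos hm, if_pos hm, if_pos hm, hm, Real.tanh_eq_sinh_div_cosh, Real.cosh_eq, Real.sinh_eq]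
      have hc : Real.exp (β * midField n ζ m₀) + Real.exp (-(β * midField n ζ m₀)) ≠ 0 := by positivity
      simp only [ha]
      field_simp
      ring
    · rw [if_neg hm, if_neg hm, if_neg hm, Real.cosh_eq]
      ring
  simp_rw [hfac]
  rw [Finset.prod_mul_distrib, Finset.prod_ite_eq' Finset.univ a, if_pos (Finset.mem_univ a),
    ← Finset.prod_coe_sort (midFinset n), mul_comm]

/-! ### The cosh product is the Boltzmann weight of the dedecorated lattice -/

/-- **The bonds of the dedecorated lattice meeting the centres, in anchored form**:
`∑_{e ∈ ℰ^b_{centres}} σ_e = ∑_{ε ∈ anchored bonds of ℤ² meeting the rescaled box} σ_{centerEmb ε.1} σ_{centerEmb ε.tip}`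
(transport of `ℰ^b` along the local isomorphism `centerEmb`, `edgesTouching_map`).
[cite: VanenterFernandezSokal1993, §4.1.2 Step 1, Figure 3(c)] -/
theorem sum_edgesTouching_oddGraph_centerFinset (n : ℕ) (ζ : SpinConfig (Site 2)) :
    ∑ e ∈ edgesTouching oddGraph (centerFinset n), bondSpin ζ e =
      ∑ ε ∈ anchT (rescaledBox n), spinAt (centerEmb ε.1) ζ * spinAt (centerEmb ε.tip) ζ := by
  rw [centerFinset_eq_map, edgesTouching_map centerEmb (fun x _ y => oddGraph_adj_centerEmb_iff x y)
    (fun _ _ _ hy => oddGraph_exists_of_adj hy), Finset.sum_map]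
  simp only [Function.Embedding.coeFn_mk]
  rw [sum_edgesTouching_eq_sum_anchT (rescaledBox n) (fun e => bondSpin ζ (Sym2.map centerEmb e))]
  refine Finset.sum_congr rfl fun ε _ => ?_
  simp [toSym2, bondSpin_mk]

/-- **Dedecoration of the Boltzmann weights**: with the centres frozen to `τ₂` (and all other
non-midpoints `+`), the product of the one-bond partition functions of the midpoints of the box is
`(2e^{J'})^N · w^{+}_{oddGraph; centres; J'}(τ₂)` — "yielding an effective coupling `J'` … The
result is an ordinary ferromagnetic Ising model" with `+` boundary condition (the boundary midpoints
contribute the field `h' = J'` from their outside centre, frozen `+`).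
[cite: VanenterFernandezSokal1993, §4.1.2 Step 1 and Step 2, Figure 4(d)–(e)] -/
theorem prod_cosh_midField_eq (n : ℕ) (β : ℝ) (τ₂ : ↥(centerFinset n) → ℤˣ) :
    ∏ m ∈ midFinset n, 2 * Real.cosh (β * midField n (glue (centerFinset n) τ₂ (.fixed 1)) m) =
      (2 * Real.exp (PairIsing.decorK β)) ^ (anchT (rescaledBox n)).card *
        isingWeight oddGraph (centerFinset n) (PairIsing.decorK β) 0 (.fixed 1) τ₂ := by
  set ζ := glue (centerFinset n) τ₂ (.fixed 1) with hζ
  rw [midFinset, Finset.prod_image fun ε _ ε' _ h => midOf_injective h]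
  have hfac : ∀ ε ∈ anchT (rescaledBox n), 2 * Real.cosh (β * midField n ζ (midOf ε)) =
      2 * Real.exp (PairIsing.decorK β) *
        Real.exp (PairIsing.decorK β * (spinAt (centerEmb ε.tip) ζ * spinAt (centerEmb ε.1) ζ)) := by
    intro ε hε
    rw [midField, frozenField_midOf hε]
    exact two_mul_cosh_pm_eq β (spinAt_eq_one_or_eq_neg_one _ ζ) (spinAt_eq_one_or_eq_neg_one _ ζ)
  rw [Finset.prod_congr rfl hfac, Finset.prod_mul_distrib, Finset.prod_const, ← Real.exp_sum]
  refine congrArg₂ (· * ·) rfl ?_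
  rw [isingWeight, ← hζ]
  congr 1
  simp only [isingHamiltonian, interactionEdges_fixed, zero_mul, sub_zero, mul_neg, neg_mul, neg_neg]
  rw [sum_edgesTouching_oddGraph_centerFinset, Finset.mul_sum]
  refine Finset.sum_congr rfl fun ε _ => ?_
  ring

/-! ### The two-step decomposition over the midpoints and the dedecoration theorems -/

/-- **The Boltzmann sums of the reduced system in two steps, midpoints first**: for every observable
`F`, `∑_τ w^{+}_{cut; W'_n}(τ) F(τ ∨ +) = ∑_{τ₂ : centres} ∑_{τ₁ : midpoints}
w^{τ₂ ∨ +}_{cut; midpoints}(τ₁) F(τ₁ ∨ τ₂ ∨ +)` (no extra factor: every bond meeting `W'_n` meets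
a midpoint). [cite: VanenterFernandezSokal1993, §4.1.2 Step 1 ("integrate out the spins … that have exactly two neighbors")] -/
theorem sum_isingWeight_cut_eq_sum_sum (n : ℕ) (β : ℝ) (F : SpinConfig (Site 2) → ℝ) :
    ∑ τ : ↥(internalVolume n) → ℤˣ, isingWeight (cutGraph n) (internalVolume n) β 0 (.fixed 1) τ *
        F (glue (internalVolume n) τ (.fixed 1)) =
      ∑ τ₂ : ↥(centerFinset n) → ℤˣ, ∑ τ₁ : ↥(midFinset n) → ℤˣ,
        isingWeight (cutGraph n) (midFinset n) β 0 (.fixed (glue (centerFinset n) τ₂ (.fixed 1))) τ₁ *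
          F (glue (midFinset n) τ₁ (.fixed (glue (centerFinset n) τ₂ (.fixed 1)))) := by
  rw [sum_isingWeight_fixed_eq_sum_sum (cutGraph n) (midFinset_subset n) 1 β 0 F]
  have hE : edgesTouching (cutGraph n) (internalVolume n) \ edgesTouching (cutGraph n) (midFinset n) = ∅ :=
    Finset.sdiff_eq_empty_iff_subset.2 (edgesTouching_cutGraph_internalVolume_subset n)
  simp only [hE, Finset.sum_empty, zero_mul, add_zero, mul_zero, Real.exp_zero, one_mul]
  rfl

/-- **Dedecoration for observables not reading the midpoints**:
`∑_τ w^{+}_{cut; W'_n}(τ) F(τ ∨ +) = (2e^{J'})^N ∑_{τ₂} w^{+}_{oddGraph; centres; J'}(τ₂) F(τ₂ ∨ +)`.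
[cite: VanenterFernandezSokal1993, §4.1.2 Steps 1–2] -/
theorem sum_isingWeight_cut_eq_local (n : ℕ) (β : ℝ) {F : SpinConfig (Site 2) → ℝ}
    (hF : ∀ σ σ' : SpinConfig (Site 2), (∀ z ∉ midFinset n, σ z = σ' z) → F σ = F σ') :
    ∑ τ : ↥(internalVolume n) → ℤˣ, isingWeight (cutGraph n) (internalVolume n) β 0 (.fixed 1) τ *
        F (glue (internalVolume n) τ (.fixed 1)) =
      (2 * Real.exp (PairIsing.decorK β)) ^ (anchT (rescaledBox n)).card *
        ∑ τ₂ : ↥(centerFinset n) → ℤˣ, isingWeight oddGraph (centerFinset n) (PairIsing.decorK β) 0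
          (.fixed 1) τ₂ * F (glue (centerFinset n) τ₂ (.fixed 1)) := by
  rw [sum_isingWeight_cut_eq_sum_sum, Finset.mul_sum]
  refine Finset.sum_congr rfl fun τ₂ _ => ?_
  rw [sum_isingWeight_cut_midFinset_local n β _ hF, prod_cosh_midField_eq]
  ring

/-- **The partition functions**: `Z^{+}_{cut; W'_n; β} = (2e^{J'})^N · Z^{+}_{oddGraph; centres; J'}`.
[cite: VanenterFernandezSokal1993, §4.1.2 Steps 1–2] -/
theorem isingPartitionFunction_cut_eq (n : ℕ) (β : ℝ) :
    isingPartitionFunction (cutGraph n) (internalVolume n) β 0 (.fixed 1) =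
      (2 * Real.exp (PairIsing.decorK β)) ^ (anchT (rescaledBox n)).card *
        isingPartitionFunction oddGraph (centerFinset n) (PairIsing.decorK β) 0 (.fixed 1) := by
  have := sum_isingWeight_cut_eq_local n β (F := fun _ => (1 : ℝ)) (fun _ _ _ => rfl)
  simpa only [mul_one, isingPartitionFunction] using this

/-- `plus = fixed (+1)`. [cite: FriedliVelenik2017, §3.1] -/
theorem plus_eq_fixed_one : (BoundaryCondition.plus : BoundaryCondition (Site 2)) = .fixed 1 := rfl

/-- **Dedecoration of expectations**: for a measurable observable `F` not reading the midpoints,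
`⟨F⟩^{+}_{cut; W'_n; β} = ⟨F⟩^{+}_{oddGraph; centres; J'}` — "The result is an ordinary
ferromagnetic Ising model … with nearest-neighbor coupling `J'`", with `+` boundary conditions.
[cite: VanenterFernandezSokal1993, §4.1.2 Steps 1–2, Figure 3(c) and Figure 4(e)] -/
theorem isingExpect_cut_eq_oddGraph (n : ℕ) (β : ℝ) {F : SpinConfig (Site 2) → ℝ} (hFm : Measurable F)
    (hF : ∀ σ σ' : SpinConfig (Site 2), (∀ z ∉ midFinset n, σ z = σ' z) → F σ = F σ') :
    isingExpect (cutGraph n) (internalVolume n) β 0 .plus F =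
      isingExpect oddGraph (centerFinset n) (PairIsing.decorK β) 0 .plus F := by
  have hA : (2 * Real.exp (PairIsing.decorK β)) ^ (anchT (rescaledBox n)).card ≠ 0 :=
    pow_ne_zero _ (by positivity)
  rw [plus_eq_fixed_one, isingExpect_eq_sum_div (cutGraph n) (internalVolume n) 0 _ β hFm,
    isingExpect_eq_sum_div oddGraph (centerFinset n) 0 _ (PairIsing.decorK β) hFm,
    sum_isingWeight_cut_eq_local n β hF, isingPartitionFunction_cut_eq, mul_div_mul_left _ _ hA]

/-- **Eq. (4.6): the magnetisation of a midpoint after dedecoration.** For a midpoint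
`m = midOf ε` of the box, `⟨σ_m⟩^{+}_{cut; W'_n; β} = ½ tanh 2β · (⟨σ_{centerEmb ε.tip}⟩ +
⟨σ_{centerEmb ε.1}⟩)^{+}_{oddGraph; centres; J'}` ("`⟨σ_{i₁,i₂}⟩ = ⟨tanh(J(σ'+σ''))⟩ =
⟨½ tanh 2J (σ'+σ'')⟩`, where `σ'` and `σ''` are the two internal spins adjacent to `σ_{i₁,i₂}`").
[cite: VanenterFernandezSokal1993, §4.1.2 Step 2 eq. (4.6)] -/
theorem isingExpect_cut_spinAt_midOf {n : ℕ} (β : ℝ) {ε : AEdge} (hε : ε ∈ anchT (rescaledBox n)) :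
    isingExpect (cutGraph n) (internalVolume n) β 0 .plus (spinAt (midOf ε)) =
      Real.tanh (2 * β) / 2 *
        (isingExpect oddGraph (centerFinset n) (PairIsing.decorK β) 0 .plus (spinAt (centerEmb ε.tip)) +
          isingExpect oddGraph (centerFinset n) (PairIsing.decorK β) 0 .plus (spinAt (centerEmb ε.1))) := by
  have hA : (2 * Real.exp (PairIsing.decorK β)) ^ (anchT (rescaledBox n)).card ≠ 0 :=
    pow_ne_zero _ (by positivity)
  have hm₀ : midOf ε ∈ midFinset n := mem_midFinset_iff.2 ⟨ε, hε, rfl⟩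
  have hZ := isingPartitionFunction_pos oddGraph (centerFinset n) (PairIsing.decorK β) 0 (.fixed 1)
  set A := (2 * Real.exp (PairIsing.decorK β)) ^ (anchT (rescaledBox n)).card with hAdef
  set Su := ∑ τ₂ : ↥(centerFinset n) → ℤˣ, isingWeight oddGraph (centerFinset n) (PairIsing.decorK β) 0
    (.fixed 1) τ₂ * spinAt (centerEmb ε.tip) (glue (centerFinset n) τ₂ (.fixed 1)) with hSu
  set Sv := ∑ τ₂ : ↥(centerFinset n) → ℤˣ, isingWeight oddGraph (centerFinset n) (PairIsing.decorK β) 0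
    (.fixed 1) τ₂ * spinAt (centerEmb ε.1) (glue (centerFinset n) τ₂ (.fixed 1)) with hSv
  -- numerator
  have hnum : ∑ τ : ↥(internalVolume n) → ℤˣ, isingWeight (cutGraph n) (internalVolume n) β 0 (.fixed 1) τ *
      spinAt (midOf ε) (glue (internalVolume n) τ (.fixed 1)) = A * (Real.tanh (2 * β) / 2) * (Su + Sv) := by
    rw [sum_isingWeight_cut_eq_sum_sum, hSu, hSv, ← Finset.sum_add_distrib, Finset.mul_sum]
    refine Finset.sum_congr rfl fun τ₂ _ => ?_
    rw [sum_isingWeight_cut_midFinset_spinAt n β _ hm₀, prod_cosh_midField_eq, midField,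
      frozenField_midOf hε, tanh_pm_add_eq β (spinAt_eq_one_or_eq_neg_one _ _)
        (spinAt_eq_one_or_eq_neg_one _ _), ← hAdef]
    ring
  rw [plus_eq_fixed_one, isingExpect_eq_sum_div (cutGraph n) (internalVolume n) 0 _ β (measurable_spinAt _),
    hnum, isingPartitionFunction_cut_eq, ← hAdef,
    isingExpect_eq_sum_div oddGraph (centerFinset n) 0 _ (PairIsing.decorK β) (measurable_spinAt _),
    isingExpect_eq_sum_div oddGraph (centerFinset n) 0 _ (PairIsing.decorK β) (measurable_spinAt _),
    ← hSu, ← hSv]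
  field_simp

end Literature.Barriers.CriticalPhenomena.NonGibbs

end
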